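/-
  Summits/AtomisticToContinuum/Crystallization/Theorems/OverbindingBudgetAffineFarCoreWindow.lean

  residual stmt-AtomisticToContinuum-31280 · slot Z `FarAggregatePricing 12 (1/25) (1/2000) (1/(2·10⁷))` · leaf LAB₁′ `ShelteredShellLabelling'`
  (leaf list v14′, critic rows 890/899): CORE tool-box 4 for `CoreRechart (1/25)` (engine piece E3 of LAB₁′; critic row 899 docket (2)) —
  recentring a stacking at a site, near-isometry and Archimedean scale bounds, and the two window theorems `core_identification` /
  `core_key` that combine C1–C3.  decomp-a2c lens-4 «minimal counterexample / extremal reduction», generation 58.  Imports C3 `…FarCoreShells`.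
  0 sorry · 0 axiom · no instance · no notation · no option.
-/
import Summits.AtomisticToContinuum.Crystallization.Theorems.OverbindingBudgetAffineFarCoreShells

/-! # CORE tool-box 4 — recentring, scale bounds, identification and the window equivalence (PROVED)

Setting (as in C2/C3): an affine chart `x ↦ c.a₀ c.B x` of `𝓛(c.s)` and a based copy `z ↦ a₀ B₀ z`, `z ∈ Z = g(𝓛(s) − p₀)`, two-way
`ε`-matched over the `(899/100) nn`-window.  §2: `𝓛(s(· + k₀)) = 𝓛(s) − p₀` for a site `p₀` of layer `k₀` (`mem_shift_iff`); a
`3/25`-near-isometry is `(22/25, 28/25)`-bounded; the ARCHIMEDEAN scale bound `a₀ ≥ (25/28)(99/100) nn` (`core_scale_lower`: multiples of an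
in-layer copy vector cannot land in `(nn/100, (99/100)nn)` around the centre).  §3: `core_identification` (origin isometry `U` of C3 +
minimal-counterexample identification of C2 + the net bound of C1 §5 for the defect `c.a₀ c.B − a₀ B₀ U`) and the window equivalence
`core_key`: for `R = U⁻¹ g` and `c.a₀‖c.B (R p)‖ < (44/5) c.nn`, `R p ∈ 𝓛(c.s) ↔ p + p₀ ∈ 𝓛(s)`.
-/

namespace Summit.AtomisticToContinuum.Crystallization.Theorems.OverbindingBudgetAffineFarSmoothSplit

open scoped BigOperators RealInnerProductSpace
open Literature.MathematicalPhysics.StatisticalMechanics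
open Literature.Geometry.DiscreteGeometry (layerSpacing layerShell hexagonSet hexagonSet_subset_layerShell norm_sq_fin3 nearestDist
  nearestDist_nonneg nearestDist_le_dist)

/-! ## §2  Recentring a stacking at a site; near-isometry bounds; the Archimedean scale bound (PROVED) -/

/-- Positions of the recentred word are the original positions shifted by the base site. [this file] -/
theorem barlowPos_shift (s : ℤ → ℤ) (k₀ i₀ j₀ m i j : ℤ) :
    barlowPos 1 (Real.sqrt (2 / 3)) (fun n => s (n + k₀)) m i j + barlowPos 1 (Real.sqrt (2 / 3)) s k₀ i₀ j₀ =
      barlowPos 1 (Real.sqrt (2 / 3)) s (m + k₀) (i + i₀) (j + j₀) := by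
  have haggLabel_shift : ∀ (s : ℤ → ℤ) (k₀ m : ℤ), haggLabel (fun n => s (n + k₀)) m = haggLabel s (m + k₀) - haggLabel s k₀ := by
    intro s k₀ m
    induction m using Int.induction_on with
    | zero => rw [zero_add, sub_self]; exact haggLabel_zero _
    | succ n ih =>
      rw [haggLabel_succ, ih, show (n : ℤ) + 1 + k₀ = (n + k₀) + 1 by ring, haggLabel_succ]; ring
    | pred n ih =>
      have h1 := haggLabel_succ (fun n => s (n + k₀)) (-(n : ℤ) - 1)
      have h2 := haggLabel_succ s (-(n : ℤ) - 1 + k₀)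
      rw [show -(n : ℤ) - 1 + 1 = -n by ring, ih] at h1
      rw [show -(n : ℤ) - 1 + k₀ + 1 = -n + k₀ by ring] at h2
      linarith
  simp only [barlowPos, haggLabel_shift]; push_cast; module

/-- **Recentring**: `𝓛(s(· + k₀)) = 𝓛(s) − p₀` for a site `p₀` of layer `k₀`. [this file] -/
theorem mem_shift_iff {s : ℤ → ℤ} {k₀ i₀ j₀ : ℤ} {p₀ : EuclideanSpace ℝ (Fin 3)} (hp₀ : p₀ = barlowPos 1 (Real.sqrt (2 / 3)) s k₀ i₀ j₀)
    (p : EuclideanSpace ℝ (Fin 3)) :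
    p ∈ barlowStacking 1 (Real.sqrt (2 / 3)) (fun n => s (n + k₀)) ↔ p + p₀ ∈ barlowStacking 1 (Real.sqrt (2 / 3)) s := by
  subst hp₀
  constructor
  · rintro ⟨m, i, j, rfl⟩
    exact ⟨m + k₀, i + i₀, j + j₀, by rw [barlowPos_shift]⟩
  · rintro ⟨m, i, j, h⟩
    refine ⟨m - k₀, i - i₀, j - j₀, ?_⟩
    have h' := barlowPos_shift s k₀ i₀ j₀ (m - k₀) (i - i₀) (j - j₀)
    simp only [sub_add_cancel] at h'
    rw [← h] at h'
    exact ((add_left_inj _).mp h').symm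

/-- A `3/25`-near-isometry is `(22/25, 28/25)`-bounded. [this file] -/
theorem near_iso_bounds {B : EuclideanSpace ℝ (Fin 3) →ₗ[ℝ] EuclideanSpace ℝ (Fin 3)}
    (hB : ∃ Q : EuclideanSpace ℝ (Fin 3) →ₗᵢ[ℝ] EuclideanSpace ℝ (Fin 3), ∀ v, ‖B v - Q v‖ ≤ 3 * (1 / 25) * ‖v‖) :
    (∀ v, 22 / 25 * ‖v‖ ≤ ‖B v‖) ∧ ∀ v, ‖B v‖ ≤ 28 / 25 * ‖v‖ := by
  obtain ⟨Q, hQ⟩ := hB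
  refine ⟨fun v => ?_, fun v => ?_⟩
  · have h1 : ‖Q v‖ ≤ ‖B v‖ + ‖Q v - B v‖ := norm_le_insert' _ _
    rw [norm_sub_rev, Q.norm_map] at h1
    linarith [hQ v]
  · have h1 : ‖B v‖ ≤ ‖Q v‖ + ‖B v - Q v‖ := norm_le_insert' _ _
    rw [Q.norm_map] at h1
    linarith [hQ v]

/-- **Archimedean scale bound.**  If every multiple `jℓ ≤ (899/100) nn` (`j ≥ 1`) of a length `ℓ > 0` is `≤ nn/100` or `≥ (99/100) nn`,
then `ℓ ≥ (99/100) nn` (else some multiple lands in `(nn/2, nn/2 + ℓ]`). [this file] -/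
theorem scale_lower_bound {ℓ nn : ℝ} (hℓ : 0 < ℓ) (hnn : 0 < nn)
    (hdich : ∀ j : ℕ, 1 ≤ j → (j : ℝ) * ℓ ≤ 899 / 100 * nn → (j : ℝ) * ℓ ≤ nn / 100 ∨ 99 / 100 * nn ≤ (j : ℝ) * ℓ) :
    99 / 100 * nn ≤ ℓ := by
  by_cases hbig : 899 / 100 * nn < ℓ
  · linarith
  push Not at hbig
  rcases hdich 1 le_rfl (by simpa using hbig) with h1 | h1
  · exfalso
    simp only [Nat.cast_one, one_mul] at h1
    have hfl := Nat.floor_le (show 0 ≤ nn / (2 * ℓ) by positivity)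
    have hlt := Nat.lt_floor_add_one (nn / (2 * ℓ))
    have e1 : nn / (2 * ℓ) * ℓ = nn / 2 := by field_simp
    have hj1 : nn / 2 < ((⌊nn / (2 * ℓ)⌋₊ + 1 : ℕ) : ℝ) * ℓ := by
      rw [← e1]; push_cast; exact mul_lt_mul_of_pos_right hlt hℓ
    have hj2 : ((⌊nn / (2 * ℓ)⌋₊ + 1 : ℕ) : ℝ) * ℓ ≤ nn / 2 + ℓ := by
      push_cast
      have : (⌊nn / (2 * ℓ)⌋₊ : ℝ) * ℓ ≤ nn / (2 * ℓ) * ℓ := mul_le_mul_of_nonneg_right hfl hℓ.le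
      rw [e1] at this; linarith
    rcases hdich (⌊nn / (2 * ℓ)⌋₊ + 1) (by omega) (by linarith) with h | h <;> linarith
  · simpa using h1

/-- **Archimedean scale bound for a based copy.**  If the based copy `y i + a₀ B₀ g(𝓛(s) − p₀)` has a configuration point within `η nn` of
each of its sites in the `9nn`-window, then `a₀ ≥ (25/28)(99/100) nn`: the in-layer row `p₀ + j u₁` of `𝓛(s)` maps to multiples of a vector
of length `ℓ = a₀‖B₀ g u₁‖`, each within `nn/100` of `y i` or beyond `(99/100) nn` (nearest distance), so `ℓ ≥ (99/100) nn`
(`scale_lower_bound`). [this file] -/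
theorem core_scale_lower {N : ℕ} {y : Fin N → EuclideanSpace ℝ (Fin 3)} {i : Fin N} {a₀ η : ℝ} {B₀ : EuclideanSpace ℝ (Fin 3) →ₗ[ℝ] EuclideanSpace ℝ (Fin 3)} (g : EuclideanSpace ℝ (Fin 3) ≃ₗᵢ[ℝ] EuclideanSpace ℝ (Fin 3)) {s : ℤ → ℤ}
    {p₀ : EuclideanSpace ℝ (Fin 3)} {k₀ i₀ j₀ : ℤ} (hp₀ : p₀ = barlowPos 1 (Real.sqrt (2 / 3)) s k₀ i₀ j₀) (ha₀ : 0 < a₀)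
    (hlo₀ : ∀ v, 22 / 25 * ‖v‖ ≤ ‖B₀ v‖) (hhi₀ : ∀ v, ‖B₀ v‖ ≤ 28 / 25 * ‖v‖) (hη1 : η ≤ 1 / 100)
    (hnn : 0 < nearestDist y i)
    (hpt : ∀ q ∈ barlowStacking 1 (Real.sqrt (2 / 3)) s, a₀ * ‖B₀ (g (q - p₀))‖ ≤ 9 * nearestDist y i →
      ∃ k : Fin N, dist (y k) (y i + a₀ • B₀ (g (q - p₀))) ≤ η * nearestDist y i) :
    99 / 100 * nearestDist y i ≤ a₀ * (28 / 25) := by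
  have hηnn : η * nearestDist y i ≤ nearestDist y i / 100 := by
    have := mul_le_mul_of_nonneg_right hη1 hnn.le; linarith
  have nb : ∀ z, ‖a₀ • B₀ z‖ = a₀ * ‖B₀ z‖ := fun z => by rw [norm_smul, Real.norm_eq_abs, abs_of_pos ha₀]
  have hu₁ : ‖triangularVec₁ (1 : ℝ)‖ = 1 := by
    have h : ‖triangularVec₁ (1 : ℝ)‖ ^ 2 = 1 := by
      rw [norm_sq_fin3]; simp [triangularVec₁]
    exact (pow_eq_one_iff_of_nonneg (norm_nonneg _) two_ne_zero).mp h
  have hju : ∀ j : ℕ, p₀ + (j : ℝ) • triangularVec₁ (1 : ℝ) ∈ barlowStacking 1 (Real.sqrt (2 / 3)) s := fun j =>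
    ⟨k₀, i₀ + j, j₀, by rw [hp₀]; simp only [barlowPos]; push_cast; module⟩
  have hℓpos : 0 < a₀ * ‖B₀ (g (triangularVec₁ (1 : ℝ)))‖ := by
    have := hlo₀ (g (triangularVec₁ (1 : ℝ)))
    rw [g.norm_map, hu₁] at this
    exact mul_pos ha₀ (by linarith)
  have hdich : ∀ j : ℕ, 1 ≤ j → (j : ℝ) * (a₀ * ‖B₀ (g (triangularVec₁ (1 : ℝ)))‖) ≤ 899 / 100 * nearestDist y i →
      (j : ℝ) * (a₀ * ‖B₀ (g (triangularVec₁ (1 : ℝ)))‖) ≤ nearestDist y i / 100 ∨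
        99 / 100 * nearestDist y i ≤ (j : ℝ) * (a₀ * ‖B₀ (g (triangularVec₁ (1 : ℝ)))‖) := by
    intro j hj hjρ
    have hzj : a₀ • B₀ (g (p₀ + (j : ℝ) • triangularVec₁ (1 : ℝ) - p₀)) = (j : ℝ) • (a₀ • B₀ (g (triangularVec₁ (1 : ℝ)))) := by
      rw [add_sub_cancel_left, map_smul, map_smul, smul_comm]
    have hnj : ‖(j : ℝ) • (a₀ • B₀ (g (triangularVec₁ (1 : ℝ))))‖ = (j : ℝ) * (a₀ * ‖B₀ (g (triangularVec₁ (1 : ℝ)))‖) := by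
      rw [norm_smul, Real.norm_eq_abs, abs_of_nonneg (Nat.cast_nonneg j), nb]
    obtain ⟨k, hk⟩ := hpt _ (hju j) (by rw [← nb, hzj, hnj]; linarith)
    rw [hzj] at hk
    have h3 : dist (y i) (y i + (j : ℝ) • (a₀ • B₀ (g (triangularVec₁ (1 : ℝ))))) =
        (j : ℝ) * (a₀ * ‖B₀ (g (triangularVec₁ (1 : ℝ)))‖) := by
      rw [dist_eq_norm, sub_add_cancel_left, norm_neg, hnj]
    by_cases hki : k = i
    · left
      rw [hki, h3] at hk
      linarith
    · right
      have h1 : nearestDist y i ≤ dist (y i) (y k) := nearestDist_le_dist y hki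
      have h2 : dist (y i) (y k) ≤ dist (y i) (y i + (j : ℝ) • (a₀ • B₀ (g (triangularVec₁ (1 : ℝ))))) +
          dist (y k) (y i + (j : ℝ) • (a₀ • B₀ (g (triangularVec₁ (1 : ℝ))))) := dist_triangle_right _ _ _
      rw [h3] at h2
      linarith
  refine (scale_lower_bound hℓpos hnn hdich).trans ?_
  have := hhi₀ (g (triangularVec₁ (1 : ℝ)))
  rw [g.norm_map, hu₁] at this
  exact mul_le_mul_of_nonneg_left (by linarith) ha₀.le

/-! ## §3  Identification and the window equivalence (PROVED) -/

/-- **Identification and defect bound.**  From the two `ε`-matchings `M1`/`M2` of `c.a₀ c.B 𝓛(c.s)` with `a₀ B₀ Z`, `Z = g(𝓛(s) − p₀)`, over the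
`(899/100) nn`-window and the scale bounds: an isometry `U` with `z = U x` for every matched pair in the window (C3 origin isometry + C2
minimal counterexample) and `‖c.a₀ c.B v − a₀ B₀ U v‖ ≤ (4ε/17)‖v‖` (net bound, C1 §5). [this file] -/
theorem core_identification {c : Chart} (hcs : IsHaggSeq c.s) {s : ℤ → ℤ} (hs : IsHaggSeq s) {p₀ : EuclideanSpace ℝ (Fin 3)}
    (hp₀ : p₀ ∈ barlowStacking 1 (Real.sqrt (2 / 3)) s) (g : EuclideanSpace ℝ (Fin 3) ≃ₗᵢ[ℝ] EuclideanSpace ℝ (Fin 3)) {B₀ : EuclideanSpace ℝ (Fin 3) →ₗ[ℝ] EuclideanSpace ℝ (Fin 3)} {a₀ ε nn : ℝ}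
    (hca : 0 < c.a₀) (ha₀ : 0 < a₀) (hlo : ∀ v, 22 / 25 * ‖v‖ ≤ ‖c.B v‖) (hhi : ∀ v, ‖c.B v‖ ≤ 28 / 25 * ‖v‖)
    (hlo₀ : ∀ v, 22 / 25 * ‖v‖ ≤ ‖B₀ v‖) (hhi₀ : ∀ v, ‖B₀ v‖ ≤ 28 / 25 * ‖v‖) (hε0 : 0 ≤ ε) (hnn : 0 < nn) (hεnn : ε ≤ nn / 50)
    (hcnn_hi : c.nn ≤ 101 / 100 * nn) (hca_hi : c.a₀ * (22 / 25) ≤ c.nn) (hca_lo : 99 / 100 * nn ≤ c.a₀ * (28 / 25))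
    (ha₀_hi : a₀ * (22 / 25) ≤ c.nn + ε) (ha₀_lo : 99 / 100 * nn ≤ a₀ * (28 / 25))
    (M1 : ∀ x ∈ barlowStacking 1 (Real.sqrt (2 / 3)) c.s, ‖c.a₀ • c.B x‖ ≤ 899 / 100 * nn →
      ∃ z ∈ basedImage g.toLinearIsometry s p₀, ‖c.a₀ • c.B x - a₀ • B₀ z‖ ≤ ε)
    (M2 : ∀ z ∈ basedImage g.toLinearIsometry s p₀, ‖a₀ • B₀ z‖ ≤ 899 / 100 * nn →
      ∃ x ∈ barlowStacking 1 (Real.sqrt (2 / 3)) c.s, ‖c.a₀ • c.B x - a₀ • B₀ z‖ ≤ ε) :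
    ∃ U : EuclideanSpace ℝ (Fin 3) ≃ₗᵢ[ℝ] EuclideanSpace ℝ (Fin 3),
      (∀ x ∈ barlowStacking 1 (Real.sqrt (2 / 3)) c.s, ‖c.a₀ • c.B x‖ ≤ 899 / 100 * nn →
        ∀ z ∈ basedImage g.toLinearIsometry s p₀, ‖c.a₀ • c.B x - a₀ • B₀ z‖ ≤ ε → z = U x) ∧
      ∀ v, ‖c.a₀ • c.B v - a₀ • B₀ (U v)‖ ≤ ε / (5 - 3 / 4) * ‖v‖ := by
  have nc : ∀ x, ‖c.a₀ • c.B x‖ = c.a₀ * ‖c.B x‖ := fun x => by rw [norm_smul, Real.norm_eq_abs, abs_of_pos hca]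
  have nb : ∀ z, ‖a₀ • B₀ z‖ = a₀ * ‖B₀ z‖ := fun z => by rw [norm_smul, Real.norm_eq_abs, abs_of_pos ha₀]
  have hVg : ∀ v, g.toLinearIsometry v = g v := fun v => rfl
  have hσ := cast_letter_eq hcs 0
  have hτ := neg_cast_letter_eq hcs (0 - 1)
  have h12c : 12 * ε < c.a₀ := by linarith
  have h12b : 12 * ε < a₀ := by linarith
  have h30 : 30 * ε < 22 / 25 * a₀ := by linarith
  -- the origin isometry `U` (C3)
  have hMX : ∀ x ∈ barlowShell (c.s 0 : ℝ) (-((c.s (0 - 1) : ℤ) : ℝ)),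
      ∃ z ∈ basedImage g.toLinearIsometry s p₀, ‖c.a₀ • c.B x - a₀ • B₀ z‖ ≤ ε := by
    intro x hx
    refine M1 x (mem_of_mem_originShell hcs hx) ?_
    have h1 := hhi x
    rw [norm_eq_one_of_mem_barlowShell hσ hτ hx] at h1
    have h2 : c.a₀ * ‖c.B x‖ ≤ c.a₀ * (28 / 25) := mul_le_mul_of_nonneg_left (by linarith) hca.le
    rw [nc]; linarith
  have hMZ : ∀ z ∈ basedImage g.toLinearIsometry s p₀, ‖z‖ = 1 →
      ∃ x ∈ barlowStacking 1 (Real.sqrt (2 / 3)) c.s, ‖c.a₀ • c.B x - a₀ • B₀ z‖ ≤ ε := by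
    intro z hz hz1
    refine M2 z hz ?_
    have h1 := hhi₀ z
    rw [hz1] at h1
    have h2 : a₀ * ‖B₀ z‖ ≤ a₀ * (28 / 25) := mul_le_mul_of_nonneg_left (by linarith) ha₀.le
    rw [nb]; linarith
  obtain ⟨U, hUsh, hD3⟩ := exists_origin_isometry hcs hs hp₀ g.toLinearIsometry hca ha₀ hlo hhi hlo₀ hhi₀ hε0 h12c h12b hMX hMZ
  -- identification throughout the window (C2)
  have IDENT : ∀ x ∈ barlowStacking 1 (Real.sqrt (2 / 3)) c.s, ‖c.a₀ • c.B x‖ ≤ 899 / 100 * nn →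
      ∀ z ∈ basedImage g.toLinearIsometry s p₀, ‖c.a₀ • c.B x - a₀ • B₀ z‖ ≤ ε → z = U x := by
    have hΦb : ∀ v, 22 / 25 * a₀ * ‖v‖ ≤ ‖(a₀ • B₀) v‖ := fun v => by
      rw [LinearMap.smul_apply, nb]; have := mul_le_mul_of_nonneg_left (hlo₀ v) ha₀.le; linarith
    have hD : ∀ v, ‖(c.a₀ • c.B) v - (a₀ • B₀) (U.toLinearIsometry v)‖ ≤ 3 * ε * ‖v‖ := fun v => by
      simp only [LinearMap.smul_apply, LinearIsometryEquiv.coe_toLinearIsometry]; exact hD3 v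
    have hU : ∀ e ∈ barlowShell (c.s 0 : ℝ) (-((c.s (0 - 1) : ℤ) : ℝ)), U.toLinearIsometry e ∈ basedImage g.toLinearIsometry s p₀ :=
      fun e he => (hUsh e he).1
    have hM : ∀ x ∈ barlowStacking 1 (Real.sqrt (2 / 3)) c.s, ‖(c.a₀ • c.B) x‖ ≤ 899 / 100 * nn →
        ∃ z ∈ basedImage g.toLinearIsometry s p₀, ‖(c.a₀ • c.B) x - (a₀ • B₀) z‖ ≤ ε := fun x hx hρ => by
      simp only [LinearMap.smul_apply] at hρ ⊢; exact M1 x hx hρ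
    have h := eq_of_matched hcs hs hp₀ (ρ := 899 / 100 * nn) hca hlo hhi hΦb hε0 h30 U.toLinearIsometry hD hU hM
    intro x hx hρ z hz hm
    have := h x hx (by simpa only [LinearMap.smul_apply] using hρ) z hz (by simpa only [LinearMap.smul_apply] using hm)
    simpa using this
  refine ⟨U, IDENT, ?_⟩
  -- the defect `D = c.a₀ c.B − a₀ B₀ U` is `ε`-small on the identified net, hence small (C1 §5)
  set D : EuclideanSpace ℝ (Fin 3) →ₗ[ℝ] EuclideanSpace ℝ (Fin 3) := c.a₀ • c.B - (a₀ • B₀) ∘ₗ (U.toLinearEquiv : EuclideanSpace ℝ (Fin 3) →ₗ[ℝ] EuclideanSpace ℝ (Fin 3)) with hDdef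
  have hDapp : ∀ v, D v = c.a₀ • c.B v - a₀ • B₀ (U v) := by
    intro v
    rw [hDdef, LinearMap.sub_apply, LinearMap.smul_apply, LinearMap.comp_apply, LinearMap.smul_apply]
    rfl
  have hnet : ∀ w : EuclideanSpace ℝ (Fin 3), ‖w‖ ≤ 5 → ∃ n, ‖n - w‖ ≤ 3 / 4 ∧ ‖D n‖ ≤ ε := by
    intro w hw
    obtain ⟨q, hq, hdq⟩ := exists_mem_barlowStacking_dist_sq_le (a := 1) one_ne_zero (h := Real.sqrt (2 / 3)) (by positivity) s
      (g.symm (U w) + p₀)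
    have h23 : Real.sqrt (2 / 3) ^ 2 = 2 / 3 := Real.sq_sqrt (by norm_num)
    rw [h23] at hdq
    have hd : dist (g.symm (U w) + p₀) q ≤ 3 / 4 := by
      have h' : dist (g.symm (U w) + p₀) q ^ 2 ≤ (3 / 4) ^ 2 := hdq.trans (by norm_num)
      exact (pow_le_pow_iff_left₀ dist_nonneg (by norm_num) two_ne_zero).mp h'
    have hzZ : g.toLinearIsometry (q - p₀) ∈ basedImage g.toLinearIsometry s p₀ := mem_basedImage_of_mem _ p₀ hq
    have hzw : ‖g.toLinearIsometry (q - p₀) - U w‖ ≤ 3 / 4 := by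
      have e : g (q - p₀) - U w = g (q - p₀ - g.symm (U w)) := by rw [map_sub g (q - p₀), g.apply_symm_apply]
      rw [hVg, e, g.norm_map, show q - p₀ - g.symm (U w) = q - (g.symm (U w) + p₀) by abel, ← dist_eq_norm, dist_comm]
      exact hd
    refine ⟨U.symm (g.toLinearIsometry (q - p₀)), ?_, ?_⟩
    · rw [← U.norm_map, map_sub, U.apply_symm_apply]; exact hzw
    · have hz_norm : ‖g.toLinearIsometry (q - p₀)‖ ≤ 23 / 4 := by
        have := norm_le_insert' (g.toLinearIsometry (q - p₀)) (U w)
        rw [U.norm_map] at this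
        linarith
      have h1 : ‖B₀ (g.toLinearIsometry (q - p₀))‖ ≤ 28 / 25 * (23 / 4) := (hhi₀ _).trans (by linarith)
      have h2 : a₀ * ‖B₀ (g.toLinearIsometry (q - p₀))‖ ≤ a₀ * (28 / 25 * (23 / 4)) := mul_le_mul_of_nonneg_left h1 ha₀.le
      have hΦbz : ‖a₀ • B₀ (g.toLinearIsometry (q - p₀))‖ ≤ 897 / 100 * nn := by rw [nb]; linarith
      obtain ⟨x', hx', hm'⟩ := M2 _ hzZ (by linarith)
      have hρ' : ‖c.a₀ • c.B x'‖ ≤ 899 / 100 * nn := by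
        have := norm_le_insert' (c.a₀ • c.B x') (a₀ • B₀ (g.toLinearIsometry (q - p₀)))
        linarith
      have hid := IDENT x' hx' hρ' _ hzZ hm'
      rw [hid, U.symm_apply_apply, hDapp, ← hid]
      exact hm'
  have hDn := norm_map_le_of_net D (r := 5) (ρ := 3 / 4) (δ := ε) (by norm_num) (by norm_num) hε0 hnet
  intro v
  rw [← hDapp]
  exact hDn v

/-- **The window equivalence.**  With `U` as in `core_identification` and `R = U⁻¹ g`: for `c.a₀‖c.B (R p)‖ < (44/5) c.nn`,
`R p ∈ 𝓛(c.s) ↔ p + p₀ ∈ 𝓛(s)`. [this file] -/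
theorem core_key {c : Chart} {s : ℤ → ℤ} {p₀ : EuclideanSpace ℝ (Fin 3)} (g : EuclideanSpace ℝ (Fin 3) ≃ₗᵢ[ℝ] EuclideanSpace ℝ (Fin 3)) {B₀ : EuclideanSpace ℝ (Fin 3) →ₗ[ℝ] EuclideanSpace ℝ (Fin 3)} {a₀ ε nn : ℝ}
    (hca : 0 < c.a₀) (hlo : ∀ v, 22 / 25 * ‖v‖ ≤ ‖c.B v‖) (hε0 : 0 ≤ ε) (hεnn : ε ≤ nn / 50)
    (hcnn_hi : c.nn ≤ 101 / 100 * nn) (hca_lo : c.nn ≤ c.a₀ * (28 / 25))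
    (M1 : ∀ x ∈ barlowStacking 1 (Real.sqrt (2 / 3)) c.s, ‖c.a₀ • c.B x‖ ≤ 899 / 100 * nn →
      ∃ z ∈ basedImage g.toLinearIsometry s p₀, ‖c.a₀ • c.B x - a₀ • B₀ z‖ ≤ ε)
    (M2 : ∀ z ∈ basedImage g.toLinearIsometry s p₀, ‖a₀ • B₀ z‖ ≤ 899 / 100 * nn →
      ∃ x ∈ barlowStacking 1 (Real.sqrt (2 / 3)) c.s, ‖c.a₀ • c.B x - a₀ • B₀ z‖ ≤ ε)
    (U : EuclideanSpace ℝ (Fin 3) ≃ₗᵢ[ℝ] EuclideanSpace ℝ (Fin 3))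
    (IDENT : ∀ x ∈ barlowStacking 1 (Real.sqrt (2 / 3)) c.s, ‖c.a₀ • c.B x‖ ≤ 899 / 100 * nn →
      ∀ z ∈ basedImage g.toLinearIsometry s p₀, ‖c.a₀ • c.B x - a₀ • B₀ z‖ ≤ ε → z = U x)
    (hD : ∀ v, ‖c.a₀ • c.B v - a₀ • B₀ (U v)‖ ≤ ε / (5 - 3 / 4) * ‖v‖) :
    ∀ p : EuclideanSpace ℝ (Fin 3), c.a₀ * ‖c.B (U.symm (g p))‖ < 44 / 5 * c.nn →
      (U.symm (g p) ∈ barlowStacking 1 (Real.sqrt (2 / 3)) c.s ↔ p + p₀ ∈ barlowStacking 1 (Real.sqrt (2 / 3)) s) := by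
  have nc : ∀ x, ‖c.a₀ • c.B x‖ = c.a₀ * ‖c.B x‖ := fun x => by rw [norm_smul, Real.norm_eq_abs, abs_of_pos hca]
  have hVg : ∀ v, g.toLinearIsometry v = g v := fun v => rfl
  intro p hp8
  have hρx : ‖c.a₀ • c.B (U.symm (g p))‖ ≤ 899 / 100 * nn := by rw [nc]; linarith
  constructor
  · intro hx
    obtain ⟨z, hz, hm⟩ := M1 _ hx hρx
    have hid := IDENT _ hx hρx z hz hm
    rw [U.apply_symm_apply] at hid
    obtain ⟨q, hq, hqz⟩ := mem_basedImage_iff.1 hz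
    rw [hid, hVg] at hqz
    have hqp : q - p₀ = p := g.injective hqz
    rw [← hqp, sub_add_cancel]; exact hq
  · intro hp
    have hzZ : g p ∈ basedImage g.toLinearIsometry s p₀ := mem_basedImage_iff.2 ⟨p + p₀, hp, by rw [add_sub_cancel_right, hVg]⟩
    have hx11 : ‖U.symm (g p)‖ ≤ 56 / 5 := by
      have h1 : c.a₀ * (22 / 25 * ‖U.symm (g p)‖) ≤ c.a₀ * ‖c.B (U.symm (g p))‖ := mul_le_mul_of_nonneg_left (hlo _) hca.le
      have h2 : c.a₀ * ‖c.B (U.symm (g p))‖ < c.a₀ * (44 / 5 * (28 / 25)) := hp8.trans_le (by linarith)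
      have h3 := lt_of_mul_lt_mul_left (h1.trans_lt h2) hca.le
      linarith
    have hDx : ‖c.a₀ • c.B (U.symm (g p)) - a₀ • B₀ (U (U.symm (g p)))‖ ≤ ε / (5 - 3 / 4) * (56 / 5) :=
      (hD _).trans (mul_le_mul_of_nonneg_left hx11 (div_nonneg hε0 (by norm_num)))
    rw [U.apply_symm_apply] at hDx
    have hΦbz : ‖a₀ • B₀ (g p)‖ ≤ 897 / 100 * nn := by
      have e1 := norm_le_insert' (a₀ • B₀ (g p)) (c.a₀ • c.B (U.symm (g p)))
      rw [norm_sub_rev, nc] at e1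
      have : ε / (5 - 3 / 4) * (56 / 5) ≤ 3 * ε := by
        rw [div_mul_eq_mul_div, div_le_iff₀ (by norm_num)]; linarith
      linarith
    obtain ⟨x'', hx'', hm''⟩ := M2 (g p) hzZ (by linarith)
    have hρ'' : ‖c.a₀ • c.B x''‖ ≤ 899 / 100 * nn := by
      have := norm_le_insert' (c.a₀ • c.B x'') (a₀ • B₀ (g p))
      linarith
    have hid := IDENT x'' hx'' hρ'' (g p) hzZ hm''
    rw [hid, U.symm_apply_apply]; exact hx''

end Summit.AtomisticToContinuum.Crystallization.Theorems.OverbindingBudgetAffineFarSmoothSplit
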